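import Mathlib.AlgebraicGeometry.Morphisms.Separated
import Mathlib.AlgebraicGeometry.Morphisms.ClosedImmersion
import Mathlib.LinearAlgebra.TensorProduct.Basic
import HarnessLib

/-!
# Sections over `Z ∩ p⁻¹U` for `Z ⊆ X`, `U ⊆ Y` affine and `p : X → Y` with `Y` separated over an affine base

Let `q : Y → Spec A` be separated, `p : X → Y` a morphism, `Z ⊆ X` and `U ⊆ Y` affine opens. Then

* `isAffineOpen_inf_preimage` — **`Z ∩ p⁻¹U` is affine** (the morphism `Z → Y` from an affine
  scheme is affine because `Z → Spec A` is and `q` is separated, Mathlib `IsAffineHom.of_comp`);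
* `exists_sum_res_mul_appLE` — **every section of `𝒪_X` over `Z ∩ p⁻¹U` is a finite sum
  `Σ_i r_i|_{Z ∩ p⁻¹U} · p^*(b_i)` with `r_i ∈ Γ(Z, 𝒪_X)`, `b_i ∈ Γ(U, 𝒪_Y)`**: the graph
  `Z ∩ p⁻¹U = Z ×_Y U → Z ×_A U = Spec (Γ(Z) ⊗_A Γ(U))` is a closed immersion, being a base change
  of the diagonal of `q` (Mathlib `pullback_map_diagonal_isPullback`), so `Γ(Z) ⊗_A Γ(U) → Γ(Z ∩ p⁻¹U)`
  is onto (Görtz–Wedhorn I, Prop. 9.15 / Def. 9.7 with Rem. 9.8: closed immersions into affines are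
  surjective on rings of sections; the classical case `X = Y`, `p = id` is the criterion
  "`Γ(U) ⊗ Γ(V) → Γ(U ∩ V)` surjective" for separatedness, Görtz–Wedhorn I, Prop. 9.15 (iii)).

This is the affine-local content of "`p_*` of a quasi-coherent module along `Z → Y` is quasi-coherent
with the expected sections" used for Chow covers `π : V' → V` (Görtz–Wedhorn II, proof of Thm. 23.17):
`Γ(π⁻¹U ∩ V'_t, 𝒪) = Γ(U, 𝒪_V) · Γ(V'_t, 𝒪)` inside `K(V')`.

Everything is proved; no named facts. Mathlib searched and used (pin): `IsOpenImmersion.isPullback`,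
`IsAffineOpen.map_fromSpec`, `IsAffineOpen.SpecMap_appLE_fromSpec`, `pullback_map_diagonal_isPullback`,
`pullbackSpecIso`, `IsClosedImmersion.isAffine_surjective_of_isAffine`, `Scheme.ΓSpecIso_naturality`,
`Spec.map_preimage`; Mathlib has the diagonal criterion but not this sections statement.

## References

* U. Görtz, T. Wedhorn, *Algebraic Geometry I: Schemes*, 2nd ed. (2020): Def. 9.7, Prop. 9.15,
  pp. 232–235. [GortzWedhorn2020]
* U. Görtz, T. Wedhorn, *Algebraic Geometry II* (2023): Thm. 23.17 and its proof, p. 424.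
  [GortzWedhorn2023]
-/

noncomputable section

open CategoryTheory CategoryTheory.Limits AlgebraicGeometry TopologicalSpace Opposite
open scoped TensorProduct

universe u

namespace Literature.AlgebraicGeometry.Morphisms

namespace SeparatedAffinePreimage

variable {X Y : Scheme.{u}} {A : Type u} [CommRing A] (p : X ⟶ Y) (q : Y ⟶ Spec (.of A))

/-! ### `Z ∩ p⁻¹U` is affine -/

/-- **`Z ∩ p⁻¹U` is affine** for affine opens `Z ⊆ X`, `U ⊆ Y` when `Y` is separated over the affine
`Spec A`: `Z → Y` is an affine morphism (`Z → Spec A` is affine, `q` is separated).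
[cite: GortzWedhorn2020, Prop. 9.15 with Rem. 9.8 (pp. 233–235)] -/
theorem isAffineOpen_inf_preimage [IsSeparated q] {Z : X.Opens} (hZ : IsAffineOpen Z) {U : Y.Opens}
    (hU : IsAffineOpen U) : IsAffineOpen (Z ⊓ p ⁻¹ᵁ U) := by
  haveI : IsAffine (Z : Scheme.{u}) := hZ
  haveI : IsAffineHom ((Z.ι ≫ p) ≫ q) := AlgebraicGeometry.isAffineHom_of_isAffine _
  haveI : IsAffineHom (Z.ι ≫ p) := IsAffineHom.of_comp (Z.ι ≫ p) q
  have h1 : IsAffineOpen ((Z.ι ≫ p) ⁻¹ᵁ U) := hU.preimage (Z.ι ≫ p)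
  have h2 := h1.image_of_isOpenImmersion Z.ι
  have e : Z.ι ''ᵁ ((Z.ι ≫ p) ⁻¹ᵁ U) = Z ⊓ p ⁻¹ᵁ U := by
    rw [Scheme.Hom.comp_preimage, Scheme.Hom.image_preimage_eq_opensRange_inf, Scheme.Opens.opensRange_ι]
  rwa [e] at h2

/-! ### The graph square -/

/-- `Spec Γ(W) → Spec Γ(Z)` is an open immersion for `W ⊆ Z` affine opens. [folklore] -/
theorem isOpenImmersion_SpecMap_presheaf_map {Z W : X.Opens} (hZ : IsAffineOpen Z)
    (hW : IsAffineOpen W) (h : W ≤ Z) :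
    IsOpenImmersion (Spec.map (X.presheaf.map (homOfLE h).op)) := by
  haveI : IsOpenImmersion (Spec.map (X.presheaf.map (homOfLE h).op) ≫ hZ.fromSpec) := by
    rw [hZ.map_fromSpec hW]; infer_instance
  exact IsOpenImmersion.of_comp _ hZ.fromSpec

/-- A point of the composite `Spec Γ(W) → Spec Γ(Z) → X` is the corresponding point of
`Spec Γ(W) → X`. [folklore] -/
theorem fromSpec_SpecMap_presheaf_map_apply {Z W : X.Opens} (hZ : IsAffineOpen Z)
    (hW : IsAffineOpen W) (h : W ≤ Z) (y : Spec Γ(X, W)) :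
    hZ.fromSpec (Spec.map (X.presheaf.map (homOfLE h).op) y) = hW.fromSpec y := by
  have := congrArg (fun f => f y) (congrArg (fun f : Spec Γ(X, W) ⟶ X => (f : _ → X))
    (hZ.map_fromSpec hW (homOfLE h).op))
  exact this

/-- The range of `Spec Γ(W) → Spec Γ(Z)` induced by restriction, `W ⊆ Z` affine opens, is
`fromSpec_Z⁻¹ W`. [folklore] -/
theorem range_SpecMap_presheaf_map {Z W : X.Opens} (hZ : IsAffineOpen Z) (hW : IsAffineOpen W)
    (h : W ≤ Z) :
    Set.range (Spec.map (X.presheaf.map (homOfLE h).op)) = hZ.fromSpec ⁻¹' (W : Set X) := by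
  have hinj : Function.Injective hZ.fromSpec := hZ.fromSpec.isOpenEmbedding.injective
  ext x
  constructor
  · rintro ⟨y, rfl⟩
    change hZ.fromSpec (Spec.map (X.presheaf.map (homOfLE h).op) y) ∈ (W : Set X)
    rw [fromSpec_SpecMap_presheaf_map_apply hZ hW h, ← hW.range_fromSpec]
    exact Set.mem_range_self y
  · intro (hx : hZ.fromSpec x ∈ (W : Set X))
    rw [← hW.range_fromSpec] at hx
    obtain ⟨y, hy⟩ := hx
    refine ⟨y, hinj ?_⟩
    rw [fromSpec_SpecMap_presheaf_map_apply hZ hW h, hy]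

/-- **The graph square is cartesian**: for `W = Z ∩ p⁻¹U`,
`Spec Γ(W) → Spec Γ(U)` (`p^*`) and `Spec Γ(W) → Spec Γ(Z)` (restriction) exhibit `Spec Γ(W)` as
`Spec Γ(Z) ×_Y Spec Γ(U)`. [folklore] -/
theorem isPullback_graph [IsSeparated q] {Z : X.Opens} (hZ : IsAffineOpen Z) {U : Y.Opens}
    (hU : IsAffineOpen U) :
    IsPullback (Spec.map (p.appLE U (Z ⊓ p ⁻¹ᵁ U) inf_le_right))
      (Spec.map (X.presheaf.map (homOfLE (inf_le_left : Z ⊓ p ⁻¹ᵁ U ≤ Z)).op))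
      hU.fromSpec (hZ.fromSpec ≫ p) := by
  have hW := isAffineOpen_inf_preimage p q hZ hU
  haveI := isOpenImmersion_SpecMap_presheaf_map hZ hW inf_le_left
  refine IsOpenImmersion.isPullback _ _ _ _ ?_ ?_
  · rw [hZ.map_fromSpec_assoc hW, IsAffineOpen.SpecMap_appLE_fromSpec p hU hW]
  · rw [IsAffineOpen.opensRange_fromSpec, Scheme.Hom.comp_preimage]
    ext1
    rw [Scheme.Hom.coe_opensRange, range_SpecMap_presheaf_map hZ hW inf_le_left]
    ext x
    change hZ.fromSpec x ∈ (p ⁻¹ᵁ U : Set X) ↔ hZ.fromSpec x ∈ ((Z ⊓ p ⁻¹ᵁ U : X.Opens) : Set X)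
    rw [Opens.coe_inf, Set.mem_inter_iff, iff_and_self]
    intro _
    rw [← hZ.range_fromSpec]
    exact Set.mem_range_self x

/-! ### The closed immersion into `Spec (Γ(Z) ⊗_A Γ(U))` and its consequence on sections -/

section Core

variable {R₁ R₂ C : Type u} [CommRing R₁] [CommRing R₂] [CommRing C] [Algebra A R₁] [Algebra A R₂]

/-- **The graph of a cartesian square over a separated `Y → Spec A` is a closed immersion into the
product over `A`**: for `Spec C = Spec R₁ ×_Y Spec R₂` with `Spec Rᵢ → Y → Spec A` the structure
maps, `Spec C → Spec (R₁ ⊗_A R₂)` (a base change of the diagonal of `Y → Spec A`) is a closed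
immersion; concretely there is a SURJECTIVE ring map `ψ : R₁ ⊗_A R₂ → C` with `ψ (r₁ ⊗ 1) = φ₁ r₁`,
`ψ (1 ⊗ r₂) = φ₂ r₂`. [cite: GortzWedhorn2020, Def. 9.7 and Prop. 9.15 (pp. 232–235)] -/
theorem exists_surjective_of_isPullback [IsSeparated q] (f : Spec (.of R₁) ⟶ Y) (g : Spec (.of R₂) ⟶ Y)
    (hf : f ≫ q = Spec.map (CommRingCat.ofHom (algebraMap A R₁)))
    (hg : g ≫ q = Spec.map (CommRingCat.ofHom (algebraMap A R₂)))
    (φ₁ : CommRingCat.of R₁ ⟶ CommRingCat.of C) (φ₂ : CommRingCat.of R₂ ⟶ CommRingCat.of C)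
    (sq : IsPullback (Spec.map φ₁) (Spec.map φ₂) f g) :
    ∃ ψ : R₁ ⊗[A] R₂ →+* C, Function.Surjective ψ ∧
      (∀ r, ψ (r ⊗ₜ 1) = φ₁ r) ∧ ∀ r, ψ (1 ⊗ₜ r) = φ₂ r := by
  -- the graph `Spec R₁ ×_Y Spec R₂ → Spec R₁ ×_A Spec R₂` is a base change of the diagonal of `q`
  let m : pullback f g ⟶ pullback (f ≫ q) (g ≫ q) :=
    pullback.map f g (f ≫ q) (g ≫ q) (𝟙 _) (𝟙 _) q (Category.id_comp _).symm (Category.id_comp _).symm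
  haveI hm : IsClosedImmersion m :=
    MorphismProperty.of_isPullback (P := @IsClosedImmersion) (pullback_map_diagonal_isPullback f g q)
      inferInstance
  -- the closed immersion `e : Spec C → Spec (R₁ ⊗ R₂)`
  let e : Spec (.of C) ⟶ Spec (.of (R₁ ⊗[A] R₂)) :=
    sq.isoPullback.hom ≫ m ≫ (pullback.congrHom hf hg).hom ≫ (pullbackSpecIso A R₁ R₂).hom
  haveI : IsClosedImmersion e := by
    unfold e; infer_instance
  have he₁ : e ≫ Spec.map (CommRingCat.ofHom Algebra.TensorProduct.includeLeftRingHom) = Spec.map φ₁ := by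
    unfold e m
    simp only [Category.assoc, pullbackSpecIso_hom_fst, pullback.congrHom_hom, pullback.lift_fst,
      Category.comp_id, IsPullback.isoPullback_hom_fst]
  have he₂ : e ≫ Spec.map (CommRingCat.ofHom (RingHomClass.toRingHom
      (Algebra.TensorProduct.includeRight : R₂ →ₐ[A] R₁ ⊗[A] R₂))) = Spec.map φ₂ := by
    unfold e m
    simp only [Category.assoc, pullbackSpecIso_hom_snd, pullback.congrHom_hom, pullback.lift_snd,
      Category.comp_id, IsPullback.isoPullback_hom_snd]
  -- `e = Spec ψ'`
  let ψ' : CommRingCat.of (R₁ ⊗[A] R₂) ⟶ CommRingCat.of C := Spec.preimage e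
  have hψ' : Spec.map ψ' = e := Spec.map_preimage e
  have h₁ : CommRingCat.ofHom Algebra.TensorProduct.includeLeftRingHom ≫ ψ' = φ₁ := by
    apply Spec.map_injective
    rw [Spec.map_comp, hψ', he₁]
  have h₂ : CommRingCat.ofHom (RingHomClass.toRingHom
      (Algebra.TensorProduct.includeRight : R₂ →ₐ[A] R₁ ⊗[A] R₂)) ≫ ψ' = φ₂ := by
    apply Spec.map_injective
    rw [Spec.map_comp, hψ', he₂]
  -- surjectivity from the closed immersion
  haveI : IsClosedImmersion (Spec.map ψ') := by rw [hψ']; infer_instance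
  have hsurj : Function.Surjective (Spec.map ψ').appTop :=
    (IsClosedImmersion.isAffine_surjective_of_isAffine (Spec.map ψ')).2
  have hnat := Scheme.ΓSpecIso_naturality ψ'
  refine ⟨ψ'.hom, ?_, fun r => ?_, fun r => ?_⟩
  · intro c
    obtain ⟨t, ht⟩ := hsurj ((Scheme.ΓSpecIso (.of C)).inv c)
    refine ⟨(Scheme.ΓSpecIso (.of (R₁ ⊗[A] R₂))).hom t, ?_⟩
    have := congrArg (fun φ => φ.hom t) hnat
    simp only [CommRingCat.hom_comp, RingHom.coe_comp, Function.comp_apply] at this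
    rw [← this, ht, ← CommRingCat.comp_apply, Iso.inv_hom_id]
    rfl
  · have := congrArg (fun φ => φ.hom r) h₁
    simpa using this
  · have := congrArg (fun φ => φ.hom r) h₂
    simpa using this

end Core

/-- The `A`-algebra structure `A → Γ(Y, ⊤) → Γ(Y, U)` on the sections over an open of the
`A`-scheme `q : Y → Spec A`. [folklore] -/
abbrev secAlgebra (U : Y.Opens) : Algebra A Γ(Y, U) :=
  ((Y.presheaf.map (homOfLE (le_top : U ≤ ⊤)).op).hom.comp
    ((Scheme.ΓSpecIso (.of A)).inv ≫ q.appTop).hom).toAlgebra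

/-- `Spec Γ(U) → Y → Spec A` is `Spec` of the structure map of `secAlgebra` (`U` affine).
[folklore] -/
theorem fromSpec_comp (U : Y.Opens) (hU : IsAffineOpen U) :
    letI := secAlgebra q U
    hU.fromSpec ≫ q = Spec.map (CommRingCat.ofHom (algebraMap A Γ(Y, U))) := by
  letI := secAlgebra q U
  have e1 : Y.toSpecΓ ≫ Spec.map q.appTop ≫ Spec.map (Scheme.ΓSpecIso (.of A)).inv = q := by
    rw [← Category.assoc, ← Scheme.toSpecΓ_naturality, Category.assoc,
      toSpecΓ_SpecMap_ΓSpecIso_inv, Category.comp_id]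
  nth_rw 1 [← e1]
  rw [hU.fromSpec_toSpecΓ_assoc, ← Spec.map_comp, ← Spec.map_comp]
  rfl

/-- **Sections over `Z ∩ p⁻¹U` are generated by `Γ(Z, 𝒪_X)` and `Γ(U, 𝒪_Y)`**: for `q : Y → Spec A`
separated, `p : X → Y`, and affine opens `Z ⊆ X`, `U ⊆ Y`, every `c ∈ Γ(Z ∩ p⁻¹U, 𝒪_X)` is a finite
sum `Σ_i r_i|_{Z ∩ p⁻¹U} · p^*(b_i)|_{Z ∩ p⁻¹U}` with `r_i ∈ Γ(Z, 𝒪_X)` and `b_i ∈ Γ(U, 𝒪_Y)`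
(`Γ(Z) ⊗_A Γ(U) → Γ(Z ×_Y U)` is onto, the graph being a closed immersion).
[cite: GortzWedhorn2020, Prop. 9.15 (pp. 234–235)] -/
theorem exists_sum_res_mul_appLE [IsSeparated q] {Z : X.Opens} (hZ : IsAffineOpen Z) {U : Y.Opens}
    (hU : IsAffineOpen U) (c : Γ(X, Z ⊓ p ⁻¹ᵁ U)) :
    ∃ S : Finset (Γ(X, Z) × Γ(Y, U)),
      c = ∑ st ∈ S, X.presheaf.map (homOfLE (inf_le_left : Z ⊓ p ⁻¹ᵁ U ≤ Z)).op st.1 *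
        p.appLE U (Z ⊓ p ⁻¹ᵁ U) inf_le_right st.2 := by
  classical
  letI := secAlgebra q U
  letI := secAlgebra (p ≫ q) Z
  have hf : (hZ.fromSpec ≫ p) ≫ q = Spec.map (CommRingCat.ofHom (algebraMap A Γ(X, Z))) := by
    rw [Category.assoc]; exact fromSpec_comp (p ≫ q) Z hZ
  have hg : hU.fromSpec ≫ q = Spec.map (CommRingCat.ofHom (algebraMap A Γ(Y, U))) :=
    fromSpec_comp q U hU
  obtain ⟨ψ, hψ, hψ₁, hψ₂⟩ := exists_surjective_of_isPullback q (hZ.fromSpec ≫ p) hU.fromSpec hf hg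
    (X.presheaf.map (homOfLE (inf_le_left : Z ⊓ p ⁻¹ᵁ U ≤ Z)).op)
    (p.appLE U (Z ⊓ p ⁻¹ᵁ U) inf_le_right) (isPullback_graph p q hZ hU).flip
  obtain ⟨t, rfl⟩ := hψ c
  obtain ⟨S, rfl⟩ := TensorProduct.exists_finset t
  refine ⟨S, ?_⟩
  rw [map_sum]
  refine Finset.sum_congr rfl fun st _ => ?_
  rw [show st.1 ⊗ₜ[A] st.2 = (st.1 ⊗ₜ[A] (1 : Γ(Y, U))) * ((1 : Γ(X, Z)) ⊗ₜ[A] st.2) by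
    rw [Algebra.TensorProduct.tmul_mul_tmul, mul_one, one_mul], map_mul, hψ₁, hψ₂]

end SeparatedAffinePreimage

end Literature.AlgebraicGeometry.Morphisms

end
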